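import Summits.CriticalPhenomena.Ising3DConformalLimit.Theses.FKParityRobustness
import Summits.CriticalPhenomena.Ising3DConformalLimit.Theorems.FKParityRobustnessDefs
import Summits.CriticalPhenomena.Ising3DConformalLimit.Theorems.FKParityRobustnessParityRobustMergingEvenSubgraphCount
import Summits.CriticalPhenomena.Ising3DConformalLimit.Theorems.FKParityRobustnessParityRobustMergingGrimmettJanson
import Summits.CriticalPhenomena.Ising3DConformalLimit.Theorems.FKParityRobustnessParityRobustMergingFKTransfer
import Literature.Probability.LatticeModels.LoopO1
import Literature.Probability.LatticeModels.RandomCluster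
import Literature.Probability.LatticeModels.RandomClusterFKG
import Literature.Probability.LatticeModels.CriticalTwoPointLower
import Literature.Probability.Percolation.PercolationEvents
import HarnessLib

/-!
# Skeleton line `loop-cluster-adjacency-surgery` for crux `FKFourConnectivity` (stmt-CriticalPhenomena-11254)

Route `FKParityRobustness`, crux r3 `FKFourConnectivity` = P4 (FK four-point hyperscaling on `ℤ³`):
`∃ c > 0 ∀ l ≥ 1 ∃ N₀ ∀ N ≥ N₀ ∀ a = l·tetra ⊂ Λ_N : c·φ_N[a₀↔a₁]·φ_N[a₂↔a₃] ≤ φ_N[all four aᵢ joined]`,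
`φ_N = rcMeasure G_N (fkIsingParam β_c(3)) 2 ∅` the free critical FK-Ising measure of the box graph
`G_N = (zdGraph 3).comap Subtype.val` on `↥(box 3 N)`.

## The line (crux idea `loop-cluster-adjacency-surgery`, ideator 2; triage r1: pass ×3, merged with
## `kissing-bridge-switching` — same first lemma)

Work one rung BELOW the FK measure, on the sourced loop-O(1) (high-temperature) measure
`ℓ^A_{G_N,t_c}[F] ∝ t_c^{|F|}·1[∂F = A]`, `A = {aᵢ}`, `t_c = tanh β_c(3)`, written with the landed
route vocabulary `zMass G t a P = ∑_{F ∈ 𝒯_A(G), P F} t^{|F|}` (`Theorems/FKParityRobustnessDefs.lean`).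

* STUB L (`stub_loopClustersTouch`, XL, load-bearing, the transfer target C⁺ of the idea):
  `c · Z(A) ≤ Z(A; TouchOrJoin)` at the tetrahedron, uniformly: under the critical sourced loop-O(1)
  measure of `Λ_N ⊂ ℤ³` with the four tetrahedral sources, with probability `≥ c` the `F`-cluster of
  `a₀` either holds all four sources or is LATTICE-ADJACENT (one closed bond away) to another
  source-carrying `F`-cluster.
* STUB W (`stub_tJoinWitness`, M, finite combinatorics, provable now): if a `T`-join `F` of the four
  (distinct) sources inside `ω` satisfies `TouchOrJoin`, then `ω` is all-joined or a SPLIT-WITH-CORE-CONTACT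
  configuration for one of the three pairings `0j|km`: each `F`-cluster holds an even number of
  sources (handshake), and every vertex of the `F`-cluster of `a₀` (sources `a₀, a_j`) is in the CORE of
  `(a₀, a_j)` in `ω` — no single open bond separates it from both `a₀` and `a_j` (handshake again, on the
  component cut off) — likewise on the other side.
* STUB S (`stub_contactSurgery`, M, finite combinatorics, provable now; ≡ `kissing_bound` of the merged
  card): ONE-EDGE SURGERY WITH MULTIPLICITY ONE on any finite graph, `0 < p < 1`, `q > 0`:
  `p/((1−p)q) · φ[Split(xy|zw) ∧ closed core–core contact] ≤ φ[x ↔ y, z, w]` — opening the contact bond `e`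
  multiplies the weight by `p/((1−p)q)` (two clusters merge) and `(ω, e) ↦ ω ∪ e` is injective (if
  `ω₁ ∪ e₁ = ω₂ ∪ e₂` with `e₁ ≠ e₂` then `e₂ ∈ ω₁`, and the core property of the endpoints of `e₁` in
  `ω₁ ∖ e₂` joins `x` to `z` inside `ω₂`, contradicting `Split(ω₂)`).

PROVED HERE (no `sorry`): the FK ← loop transfer `pair_mul_zMass_le` (from the LANDED even-subgraph
count, sourced Grimmett–Janson identity and switching count of the sibling crux `ParityRobustMerging`:
`φ[a₀↔a₁, a₂↔a₃] · Z(A; P) ≤ Z(A) · φ[∃ F ∈ 𝒯_A(ω), P F]` for EVERY predicate `P`), the FK-level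
waypoint `ContactOrJoinFK` (triage r1-1 sharpening: "state the residual at the FK level as
`φ[Joined ∪ ⋃_π KissingSplit_π] ≥ c·φ[pairing]`"), and the composition `FKFourConnectivity_of`:
`c·G₀₁G₂₃ ≤ c·φ[01∧23]` (FKG, tree) `≤ φ[J ∪ S₁ ∪ S₂ ∪ S₃]` (transfer + W + L) `≤ P4 + 3·P4/r` (S thrice),
`r = p_c/(2(1−p_c)) = 0.279`, so the crux holds with constant `c·r/(r+3)`. The real arithmetic is isolated
in `crux_arith` (no rewriting inside measure expressions — that is what made earlier drafts time out).

## Disproof used (`Cruxes/FKFourConnectivity/Disproof.lean` v3, refuter-cdisprove-…-11254; landed part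
## `Theorems/FKFourConnectivity/Negative/LebowitzSandwich.lean` — read; not imported, the farm nodes did not
## yet serve that module when this skeleton was checked, and nothing in it is instantiable by a stub)

No `_false_without_` theorem, no Targets, no refuted strengthening exist yet; nothing bites. Honoured:
(a) the load-bearing census "shape / criticality AND q = 2": `q = 2` enters through the Grimmett–Janson
dictionary (transfer) and the Euler/handshake structure of `T`-joins (W); criticality enters only through L
(false in every massive regime, where the two sourced loop clusters are thin tubes along the skew edges
`a₀a₁`, `a₂a₃` at mutual distance `≍ l`); the shape only identifies the three pairings (S is applied to each).
(b) `pairProducts_sub_even_le_two_mul_allJoined` / `not_FKFourConnectivity_imp_pointwise_fk_triviality`: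
the line produces P4 directly and never routes through `|U₄|`. (c) `fkFourConnectivity_analogue_beta_zero`:
nothing here uses small `p` (S needs `0 < p < 1`, which `criticalBeta_pos_holds` gives). No stub is an
instance of a landed Negative lemma (they are necessity results, not refutations).
-/

noncomputable section

open MeasureTheory Finset
open Literature.Probability.LatticeModels Literature.Probability.Percolation
open Summit.CriticalPhenomena.Ising3DConformalLimit.Cruxes.ParityRobustMerging.PlaquetteXorSurgery

namespace Summit.CriticalPhenomena.Ising3DConformalLimit.Cruxes.FKFourConnectivity.LoopClusterAdjacencySurgery

open scoped Classical

/-! ### Vocabulary of the line (finite graph; `ω : Set (Sym2 V)` a bond configuration) -/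

section Vocabulary

variable {V : Type*}

/-- `u` lies in the CORE of the source pair `(x, y)` in `ω`: `u` is joined to `x`, and after closing ANY
single open bond it is still joined to `x` or to `y` (no single open bond separates `u` from both).
Equivalent (triage r1) to "`u` is on an open edge-simple `x → y` trail"; every vertex of a connected
subgraph of `ω` whose odd-degree vertices are exactly `{x, y}` is in the core. -/
def InCore (ω : Set (Sym2 V)) (x y u : V) : Prop :=
  (openGraph ω).Reachable x u ∧
    ∀ f ∈ ω, (openGraph (ω \ {f})).Reachable x u ∨ (openGraph (ω \ {f})).Reachable y u

/-- The SPLIT-WITH-CORE-CONTACT event of the pairing `xy|zw`: `x ↔ y`, `z ↔ w`, `x ↮ z`, and some CLOSED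
bond `uv` of `G` joins a core vertex `u` of `(x, y)` to a core vertex `v` of `(z, w)`. -/
def splitContact (G : SimpleGraph V) (x y z w : V) : Set (Set (Sym2 V)) :=
  {ω | (openGraph ω).Reachable x y ∧ (openGraph ω).Reachable z w ∧ ¬ (openGraph ω).Reachable x z ∧
    ∃ u v : V, G.Adj u v ∧ s(u, v) ∉ ω ∧ InCore ω x y u ∧ InCore ω z w v}

/-- The hub event `x ↔ y, x ↔ z, x ↔ w` (all four joined, seen from `x`). -/
def hubJoined (x y z w : V) : Set (Set (Sym2 V)) :=
  {ω | (openGraph ω).Reachable x y ∧ (openGraph ω).Reachable x z ∧ (openGraph ω).Reachable x w}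

/-- TOUCH-OR-JOIN for an edge set `F` (a `T`-join of the four sources `aᵢ`): either all four sources lie
in one component of `(V, F)` (`JoinsAll`, route vocabulary), or the `F`-cluster of `a 0` is
LATTICE-ADJACENT to another source-carrying `F`-cluster: some bond `uv` of `G` has `u` in the `F`-cluster
of `a 0` and `v` outside it but `F`-joined to some source. -/
def TouchOrJoin (G : SimpleGraph V) (a : Fin 4 → V) (F : Finset (Sym2 V)) : Prop :=
  JoinsAll a F ∨
    ∃ u v : V, G.Adj u v ∧ (SimpleGraph.fromEdgeSet (↑F : Set (Sym2 V))).Reachable (a 0) u ∧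
      ¬ (SimpleGraph.fromEdgeSet (↑F : Set (Sym2 V))).Reachable (a 0) v ∧
      ∃ i, (SimpleGraph.fromEdgeSet (↑F : Set (Sym2 V))).Reachable (a i) v

end Vocabulary

/-! ### The box setting (abbreviations; `tetra`, `boxGraph N = (zdGraph 3).comap Subtype.val`, `tc = tanh β_c(3)`,
`zMass` come from the landed route vocabulary `Theorems/FKParityRobustnessDefs.lean`) -/

/-- The crux's measure: the free critical FK-Ising measure `φ_N` of the box graph on `Λ_N ⊂ ℤ³`. -/
abbrev phiN (N : ℕ) : Measure (BondConfig ↥(box 3 N)) :=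
  rcMeasure (boxGraph N) (fkIsingParam (criticalBeta 3)) 2 ∅

/-- The crux's conclusion event: all four marked vertices in one open cluster (verbatim the crux's set). -/
abbrev allJ {V : Type*} (a : Fin 4 → V) : Set (Set (Sym2 V)) :=
  {ω | ∀ i j, (openGraph ω).Reachable (a i) (a j)}

/-! ### The registered stubs (`sorry` only here) -/

/-- STUB S (M, provable now) — ONE-EDGE SURGERY WITH MULTIPLICITY ONE. For the free random-cluster
measure `φ = rcMeasure G p q ∅` of ANY finite graph, `0 < p < 1`, `0 < q`, and any four vertices:
`p/((1−p)q) · φ(splitContact xy|zw) ≤ φ(x ↔ y, z, w)`. Proof: for `ω ∈ splitContact` pick a closed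
core–core contact `e = uv`; `ω ∪ e ⊆ E(G)` joins `x,y,z,w` (`x ↔ u`, `z ↔ v`, plus `x ↔ y`, `z ↔ w`), has
`|ω|+1` open bonds and one cluster fewer (`u ∈ C(x) ≠ C(z) ∋ v`), so `w(ω ∪ e) = p/((1−p)q)·w(ω)`
(`rcWeight`); and `ω ↦ ω ∪ e(ω)` is injective on `splitContact`: if `ω₁ ∪ e₁ = ω₂ ∪ e₂`, `e₁ ≠ e₂`, then
`e₂ ∈ ω₁`, `ω₂ ⊇ (ω₁ ∖ e₂) ∪ e₁`, and the core property of `u₁` (resp. `v₁`) in `ω₁ ∖ e₂` together with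
`x ↔ y`, `z ↔ w` in `ω₂` gives `x ↔ u₁ — v₁ ↔ z` in `ω₂`, contradicting `x ↮ z`. Sum over `ω` with
`rcMeasure_real_eq_sum_indicator_mul`. The same lemma as `kissing_bound` of card `kissing-bridge-switching`
(triage r1: `InCore ⟺ OnOpenTrail`); exact identity behind it: `r·E[#core contacts; Split] = φ[Joined, B = 1]`.
Checked by exact enumeration on Q3/K6/grids (triage kit j010140 (A1)(A2), j010078 [S]). [folklore] -/
theorem stub_contactSurgery :
    ∀ (V : Type) [Fintype V] [DecidableEq V] (G : SimpleGraph V) [DecidableRel G.Adj] (p q : ℝ),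
      p ∈ Set.Ioo (0 : ℝ) 1 → 0 < q → ∀ x y z w : V,
        p / ((1 - p) * q) * (rcMeasure G p q ∅).real (splitContact G x y z w) ≤
          (rcMeasure G p q ∅).real (hubJoined x y z w) := by
  sorry

/-- STUB W (M, provable now) — `T`-JOIN WITNESS ⇒ JOIN OR CORE CONTACT, pointwise. Let `a` be injective,
`A = {aᵢ}`, `F ∈ 𝒯_A(ω)` (a `T`-join of `A` inside `ω`: `F ⊆ ω ∩ E(G)`, odd-degree vertices exactly `A`)
with `TouchOrJoin G a F`. Then `ω` is all-joined or lies in `splitContact` for one of the pairings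
`01|23, 02|13, 03|12`. Proof: every component of `(V, F)` holds an even number of sources (handshake per
component), so the `F`-cluster `K` of `a 0` holds `a 0, a j` only (else all four ⇒ joined in `ω ⊇ F`) and
the other two sources share a cluster `K'`; in the touch case `u ∈ K`, `v ∈ K'` (as `v ∉ K` is `F`-joined
to a source). CORE: for `u ∈ V(K)` and any `f ∈ ω`, if `u` reached neither `a 0` nor `a j` in `ω ∖ f` then
a fortiori not in `F ∖ f`; the `(F ∖ f)`-component `C` of `u` avoids all sources, so its odd vertices are
`C ∩ f`; `|C ∩ f| = 1` contradicts the handshake, `|C ∩ f| ∈ {0, 2}` makes `C` a component of `F` too,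
contradicting `a 0 ∈ K ∋ u`. Same for `v` and `(a k, a m)`. Finally either `a 0 ↔ a k` in `ω` (then all
joined) or not, and then `uv ∉ ω` (else `a 0 ↔ u — v ↔ a k`). Mathlib: `SimpleGraph.Walk`, handshake
`SimpleGraph.even_card_odd_degree_vertices` (on the induced component); tree:
`Literature.Combinatorics.SimpleGraph.CycleSpaceSeparators` (`exists_reachable_odd_of_odd`). [folklore] -/
theorem stub_tJoinWitness :
    ∀ (V : Type) [Fintype V] [DecidableEq V] (G : SimpleGraph V) [DecidableRel G.Adj]
      (a : Fin 4 → V), Function.Injective a → ∀ (ω : Set (Sym2 V)) (F : Finset (Sym2 V)),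
        F ∈ tJoins G ω (univ.image a) → TouchOrJoin G a F →
          ω ∈ ({ω | ∀ i j, (openGraph ω).Reachable (a i) (a j)} ∪ splitContact G (a 0) (a 1) (a 2) (a 3) ∪
            splitContact G (a 0) (a 2) (a 1) (a 3) ∪ splitContact G (a 0) (a 3) (a 1) (a 2) :
              Set (Set (Sym2 V))) := by
  sorry

/-- STUB L (XL, LOAD-BEARING; the idea's transfer target C⁺ = `LoopClustersTouch`) — there is `c > 0`
such that for every `l ≥ 1`, all large `N` and `a = l·tetra ⊂ Λ_N`:
`c · Z_{t_c}(A) ≤ Z_{t_c}(A; TouchOrJoin)`, i.e. under the critical SOURCED LOOP-O(1) measure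
`ℓ^A_{Λ_N, tanh β_c}` (law `∝ t_c^{|F|}·1[∂F = A]`, `LoopO1.lean`; `= law of odd(n^A)` of the sourced
random current `=` law of a uniform `T`-join of `φ_N[· | 𝓕_A]`, Grimmett–Janson/HJK §2) the `F`-cluster of
`a₀` joins all four sources OR comes within ONE lattice bond of the other source-carrying `F`-cluster, with
probability `≥ c` uniformly in `l`. WHY EASIER than P4 (idea card §Transfer): explicit law with an exact
VERTEX-DELETION Markov property (given `K_F(a₀) = K`, the rest is `ℓ^{A∖V(K)}` on `G_N − V(K)`), asks
only for ADJACENCY-or-meeting (weaker than the route's `SourceTrailsMeet` 11255 and than BLOB 11253),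
and the surgery cashes adjacency with no topological intersection (barrier
`TransverseCrossingsNeedNotMeet` not engaged). WHY IT MIGHT FAIL: the two conditioned-disjoint critical
HT clusters (`D_HT = 1.73`) may repel to distance `≫ 1` (triage: `E[#contacts; Split] ≤ 1/r` is FORCED
by S, so the bet is "an `O(1)`-mean integer is `≥ 1` with probability `≥ c`"); the `d = 2` analogue is
FALSE (adjacent-not-joined = polychromatic 6-arm event) while the `d = 2` crux is true — a genuinely
`d = 3` bet, MC-decidable (`P[join ∨ adjacent | 𝓕_A]`: ideator jobs j009271/j009274, triage j010132).
Must use `d = 3` and criticality (false in massive regimes). [cite: HansenJiangKlausen2025, §2] -/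
theorem stub_loopClustersTouch :
    ∃ c : ℝ, 0 < c ∧ ∀ l : ℕ, 1 ≤ l → ∃ N₀ : ℕ, ∀ N : ℕ, N₀ ≤ N →
      ∀ a : Fin 4 → ↥(box 3 N), (∀ i, ((a i : Site 3)) = (l : ℤ) • tetra i) →
        c * zMass (boxGraph N) tc a (fun _ => True) ≤ zMass (boxGraph N) tc a (TouchOrJoin (boxGraph N) a) := by
  sorry

/-! ### Proved plumbing I: the FK ← loop-O(1) transfer (from the LANDED Grimmett–Janson identity) -/

section Transfer

variable {V : Type*} [Fintype V] [DecidableEq V] (G : SimpleGraph V) [DecidableRel G.Adj]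

/-- The Grimmett–Janson normalising constant `K = 2^{|V|} (1 − p/2)^{|E|} / Z_RC` at `p = fkIsingParam β`. -/
def gjConst (β : ℝ) : ℝ :=
  2 ^ Fintype.card V * (1 - fkIsingParam β / 2) ^ #G.edgeFinset / rcPartitionFunction G (fkIsingParam β) 2 ∅

theorem gjConst_nonneg {β : ℝ} (hβ : 0 ≤ β) : 0 ≤ gjConst G β := by
  have hp : fkIsingParam β ∈ Set.Icc (0 : ℝ) 1 := fkIsingParam_mem_Icc hβ
  have hZ := rcPartitionFunction_pos G hp two_pos (∅ : Set V)
  have : 0 ≤ 1 - fkIsingParam β / 2 := by linarith [hp.2]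
  unfold gjConst
  positivity

/-- Upper half of the transfer (switching count + Grimmett–Janson at `P = ⊤`; cf. the landed
`stub_fkLoopTransfer`, step (II)): `φ[a₀↔a₁ ∧ a₂↔a₃] ≤ K · Z_{tanh β}(A)` for `a` injective. -/
theorem pairJoined_le_gjConst_mul_zMass {β : ℝ} (hβ : 0 ≤ β) (a : Fin 4 → V)
    (ha : Function.Injective a) :
    (rcMeasure G (fkIsingParam β) 2 ∅).real (openConn (a 0) (a 1) ∩ openConn (a 2) (a 3)) ≤
      gjConst G β * zMass G (Real.tanh β) a (fun _ => True) := by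
  have hp : fkIsingParam β ∈ Set.Icc (0 : ℝ) 1 := fkIsingParam_mem_Icc hβ
  have h2 : (0 : ℝ) < 2 := two_pos
  have hZ := rcPartitionFunction_pos G hp h2 (∅ : Set V)
  have ht : Real.tanh β = fkIsingParam β / (2 - fkIsingParam β) := tanh_eq_fkIsingParam_div β
  have hEC : ∀ ω : Finset (Sym2 V), ω ⊆ G.edgeFinset →
      #(evenSubgraphs G (↑ω : Set (Sym2 V))) * 2 ^ Fintype.card V =
        2 ^ (#ω + clusterCount (↑ω : Set (Sym2 V)) (∅ : Set V)) :=
    fun ω hω => card_evenSubgraphs_mul_two_pow G ω hω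
  have step1 := rcMeasure_real_apply G hp h2 (∅ : Set V)
    (openConn (a 0) (a 1) ∩ openConn (a 2) (a 3) : Set (BondConfig V))
  have step3 := grimmettJanson_identity G hEC hp (univ.image a) (fun _ => True)
  simp only [Finset.filter_true] at step3
  rw [step1]
  refine (Finset.sum_le_sum (g := fun ω' : Finset (Sym2 V) =>
    rcWeight G (fkIsingParam β) 2 ∅ ω' *
      ((#(tJoins G (↑ω' : Set (Sym2 V)) (univ.image a)) : ℝ) /
        (#(evenSubgraphs G (↑ω' : Set (Sym2 V))) : ℝ)) /
      rcPartitionFunction G (fkIsingParam β) 2 ∅) (fun ω' hω' => ?_)).trans_eq ?_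
  · have hnn : 0 ≤ rcWeight G (fkIsingParam β) 2 ∅ ω' *
        ((#(tJoins G (↑ω' : Set (Sym2 V)) (univ.image a)) : ℝ) /
          (#(evenSubgraphs G (↑ω' : Set (Sym2 V))) : ℝ)) /
        rcPartitionFunction G (fkIsingParam β) 2 ∅ :=
      div_nonneg (mul_nonneg (rcWeight_nonneg G hp h2.le ∅ ω') (by positivity)) hZ.le
    split_ifs with hmem
    · have h01 : (SimpleGraph.fromEdgeSet (↑ω' : Set (Sym2 V))).Reachable (a 0) (a 1) := hmem.1
      have h23 : (SimpleGraph.fromEdgeSet (↑ω' : Set (Sym2 V))).Reachable (a 2) (a 3) := hmem.2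
      obtain ⟨F₀, hF₀⟩ := tJoins_nonempty_of_reachable G ω' (Finset.mem_powerset.1 hω') a ha h01 h23
      have hE : (#(evenSubgraphs G (↑ω' : Set (Sym2 V))) : ℝ) ≠ 0 :=
        Nat.cast_ne_zero.2 (Finset.card_pos.2 ⟨∅, empty_mem_evenSubgraphs G _⟩).ne'
      rw [card_tJoins_eq_card_evenSubgraphs G hF₀, div_self hE, mul_one]
    · exact hnn
  · rw [← Finset.sum_div, step3]
    unfold zMass gjConst
    rw [Finset.filter_true, ht]
    ring

/-- Lower half of the transfer (Grimmett–Janson at `P`, and `#{F ∈ 𝒯_A(ω) : P F} ≤ #𝓔_∅(ω)·1[∃]`):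
`K · Z_{tanh β}(A; P) ≤ φ[∃ F ∈ 𝒯_A(ω), P F]` for EVERY predicate `P` on edge sets. -/
theorem gjConst_mul_zMass_le_exists {β : ℝ} (hβ : 0 ≤ β) (a : Fin 4 → V)
    (P : Finset (Sym2 V) → Prop) :
    gjConst G β * zMass G (Real.tanh β) a P ≤
      (rcMeasure G (fkIsingParam β) 2 ∅).real
        {ω | ∃ F ∈ tJoins G ω (univ.image a), P F} := by
  have hp : fkIsingParam β ∈ Set.Icc (0 : ℝ) 1 := fkIsingParam_mem_Icc hβ
  have h2 : (0 : ℝ) < 2 := two_pos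
  have hZ := rcPartitionFunction_pos G hp h2 (∅ : Set V)
  have ht : Real.tanh β = fkIsingParam β / (2 - fkIsingParam β) := tanh_eq_fkIsingParam_div β
  have hEC : ∀ ω : Finset (Sym2 V), ω ⊆ G.edgeFinset →
      #(evenSubgraphs G (↑ω : Set (Sym2 V))) * 2 ^ Fintype.card V =
        2 ^ (#ω + clusterCount (↑ω : Set (Sym2 V)) (∅ : Set V)) :=
    fun ω hω => card_evenSubgraphs_mul_two_pow G ω hω
  have step1 := rcMeasure_real_apply G hp h2 (∅ : Set V)
    ({ω | ∃ F ∈ tJoins G ω (univ.image a), P F} : Set (BondConfig V))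
  have step3 := grimmettJanson_identity G hEC hp (univ.image a) P
  have hL : gjConst G β * zMass G (Real.tanh β) a P =
      ∑ ω' ∈ G.edgeFinset.powerset, rcWeight G (fkIsingParam β) 2 ∅ ω' *
        ((#((tJoins G (↑ω' : Set (Sym2 V)) (univ.image a)).filter (fun F => P F)) : ℝ) /
          (#(evenSubgraphs G (↑ω' : Set (Sym2 V))) : ℝ)) / rcPartitionFunction G (fkIsingParam β) 2 ∅ := by
    rw [← Finset.sum_div, step3]
    unfold zMass gjConst
    rw [ht]
    ring
  rw [hL, step1]
  refine Finset.sum_le_sum fun ω' _ => ?_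
  split_ifs with hmem
  · refine div_le_div_of_nonneg_right ?_ hZ.le
    refine mul_le_of_le_one_right (rcWeight_nonneg G hp h2.le ∅ ω') ?_
    rcases (tJoins G (↑ω' : Set (Sym2 V)) (univ.image a)).eq_empty_or_nonempty with hemp | ⟨F₀, hF₀⟩
    · rw [hemp]
      simp
    · have hEpos : (0 : ℝ) < #(evenSubgraphs G (↑ω' : Set (Sym2 V))) := by
        exact_mod_cast Finset.card_pos.2 ⟨∅, empty_mem_evenSubgraphs G _⟩
      rw [div_le_one hEpos, ← card_tJoins_eq_card_evenSubgraphs G hF₀]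
      exact_mod_cast Finset.card_filter_le _ _
  · have hfilt : (tJoins G (↑ω' : Set (Sym2 V)) (univ.image a)).filter (fun F => P F) = ∅ := by
      rw [Finset.filter_eq_empty_iff]
      intro F hF hPF
      exact hmem ⟨F, hF, hPF⟩
    rw [hfilt]
    simp

/-- **The FK ← loop-O(1) transfer of the line** (proved): for `β ≥ 0`, `a` injective and every predicate
`P` on edge sets, `φ[a₀↔a₁ ∧ a₂↔a₃] · Z_{tanh β}(A; P) ≤ Z_{tanh β}(A) · φ[∃ F ∈ 𝒯_A(ω), P F]`, i.e.
`φ[01 ∧ 23] · ℓ^A(P) ≤ φ[ω contains a T-join of A satisfying P]` — the uniform `T`-join of `φ[· | 𝓕_A]`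
has law `ℓ^A` (sourced Grimmett–Janson). [cite: GrimmettJanson2007, Thm 3.1] -/
theorem pair_mul_zMass_le {β : ℝ} (hβ : 0 ≤ β) (a : Fin 4 → V) (ha : Function.Injective a)
    (P : Finset (Sym2 V) → Prop) :
    (rcMeasure G (fkIsingParam β) 2 ∅).real (openConn (a 0) (a 1) ∩ openConn (a 2) (a 3)) *
        zMass G (Real.tanh β) a P ≤
      zMass G (Real.tanh β) a (fun _ => True) *
        (rcMeasure G (fkIsingParam β) 2 ∅).real {ω | ∃ F ∈ tJoins G ω (univ.image a), P F} := by
  have ht : Real.tanh β = fkIsingParam β / (2 - fkIsingParam β) := tanh_eq_fkIsingParam_div β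
  have hp : fkIsingParam β ∈ Set.Icc (0 : ℝ) 1 := fkIsingParam_mem_Icc hβ
  have htanh : 0 ≤ Real.tanh β := by
    rw [ht]
    exact div_nonneg hp.1 (by linarith [hp.2])
  have hU := pairJoined_le_gjConst_mul_zMass G hβ a ha
  have hLo := gjConst_mul_zMass_le_exists G hβ a P
  have hZP : 0 ≤ zMass G (Real.tanh β) a P := zMass_nonneg G htanh a P
  have hZT : 0 ≤ zMass G (Real.tanh β) a (fun _ => True) := zMass_nonneg G htanh a _
  calc (rcMeasure G (fkIsingParam β) 2 ∅).real (openConn (a 0) (a 1) ∩ openConn (a 2) (a 3)) *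
          zMass G (Real.tanh β) a P
        ≤ (gjConst G β * zMass G (Real.tanh β) a (fun _ => True)) * zMass G (Real.tanh β) a P :=
          mul_le_mul_of_nonneg_right hU hZP
    _ = zMass G (Real.tanh β) a (fun _ => True) * (gjConst G β * zMass G (Real.tanh β) a P) := by ring
    _ ≤ zMass G (Real.tanh β) a (fun _ => True) *
          (rcMeasure G (fkIsingParam β) 2 ∅).real {ω | ∃ F ∈ tJoins G ω (univ.image a), P F} :=
          mul_le_mul_of_nonneg_left hLo hZT

end Transfer

/-! ### Proved plumbing II: the FK-level waypoint and the surgery step -/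

/-- The FK-LEVEL RESIDUAL `ContactOrJoinFK` (triage r1-1/2 sharpening; what the surgery actually consumes,
one rung ABOVE stub L and implied by it via stub W and the transfer — `contactOrJoinFK_of_loop`):
`∃ c > 0 ∀ l ≥ 1 ∃ N₀ ∀ N ≥ N₀ ∀ a = l·tetra : c·φ_N[a₀↔a₁ ∧ a₂↔a₃] ≤ φ_N[J ∪ S₀₁ ∪ S₀₂ ∪ S₀₃]`, with
`J` = all joined and `S₀ⱼ = splitContact (a 0) (a j) …` (the `0j|km` split with a closed core–core contact).
The merged card `kissing-bridge-switching`'s `CoreKissing` is the single-pairing form of this. -/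
def ContactOrJoinFK : Prop :=
  ∃ c : ℝ, 0 < c ∧ ∀ l : ℕ, 1 ≤ l → ∃ N₀ : ℕ, ∀ N : ℕ, N₀ ≤ N →
    ∀ a : Fin 4 → ↥(box 3 N), (∀ i, ((a i : Site 3)) = (l : ℤ) • tetra i) →
      c * (phiN N).real (openConn (a 0) (a 1) ∩ openConn (a 2) (a 3)) ≤
        (phiN N).real (allJ a ∪ splitContact (boxGraph N) (a 0) (a 1) (a 2) (a 3) ∪
          splitContact (boxGraph N) (a 0) (a 2) (a 1) (a 3) ∪ splitContact (boxGraph N) (a 0) (a 3) (a 1) (a 2))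

/-- Loop level ⇒ FK level (proved from stub W's and stub L's STATEMENTS and the transfer): the hypotheses
are the statements of `stub_tJoinWitness` and `stub_loopClustersTouch` verbatim. -/
theorem contactOrJoinFK_of_loop
    (hW : ∀ (V : Type) [Fintype V] [DecidableEq V] (G : SimpleGraph V) [DecidableRel G.Adj]
      (a : Fin 4 → V), Function.Injective a → ∀ (ω : Set (Sym2 V)) (F : Finset (Sym2 V)),
        F ∈ tJoins G ω (univ.image a) → TouchOrJoin G a F →
          ω ∈ ({ω | ∀ i j, (openGraph ω).Reachable (a i) (a j)} ∪ splitContact G (a 0) (a 1) (a 2) (a 3) ∪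
            splitContact G (a 0) (a 2) (a 1) (a 3) ∪ splitContact G (a 0) (a 3) (a 1) (a 2) :
              Set (Set (Sym2 V))))
    (hL : ∃ c : ℝ, 0 < c ∧ ∀ l : ℕ, 1 ≤ l → ∃ N₀ : ℕ, ∀ N : ℕ, N₀ ≤ N →
      ∀ a : Fin 4 → ↥(box 3 N), (∀ i, ((a i : Site 3)) = (l : ℤ) • tetra i) →
        c * zMass (boxGraph N) tc a (fun _ => True) ≤ zMass (boxGraph N) tc a (TouchOrJoin (boxGraph N) a)) :
    ContactOrJoinFK := by
  obtain ⟨c, hc, hL⟩ := hL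
  refine ⟨c, hc, fun l hl => ?_⟩
  obtain ⟨N₀, hN₀⟩ := hL l hl
  refine ⟨N₀, fun N hN a ha => ?_⟩
  have hβ : 0 ≤ criticalBeta 3 := criticalBeta_nonneg 3
  have hp : fkIsingParam (criticalBeta 3) ∈ Set.Icc (0 : ℝ) 1 := fkIsingParam_mem_Icc hβ
  haveI : IsProbabilityMeasure (phiN N) :=
    isProbabilityMeasure_rcMeasure (boxGraph N) hp two_pos ∅
  have hainj : Function.Injective a := tetra_injective hl a ha
  have hLT := hN₀ N hN a ha
  have hU' : (phiN N).real
        (openConn (a 0) (a 1) ∩ openConn (a 2) (a 3)) ≤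
      gjConst (boxGraph N) (criticalBeta 3) * zMass (boxGraph N) tc a (fun _ => True) :=
    pairJoined_le_gjConst_mul_zMass (boxGraph N) hβ a hainj
  have hT' : (phiN N).real
          (openConn (a 0) (a 1) ∩ openConn (a 2) (a 3)) *
        zMass (boxGraph N) tc a (TouchOrJoin (boxGraph N) a) ≤
      zMass (boxGraph N) tc a (fun _ => True) *
        (phiN N).real
          {ω | ∃ F ∈ tJoins (boxGraph N) ω (univ.image a), TouchOrJoin (boxGraph N) a F} :=
    pair_mul_zMass_le (boxGraph N) hβ a hainj (TouchOrJoin (boxGraph N) a)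
  have hK := gjConst_nonneg (boxGraph N) hβ
  -- the witness inclusion
  have hincl : (phiN N).real
        {ω | ∃ F ∈ tJoins (boxGraph N) ω (univ.image a), TouchOrJoin (boxGraph N) a F} ≤
      (phiN N).real
        (allJ a ∪ splitContact (boxGraph N) (a 0) (a 1) (a 2) (a 3) ∪
          splitContact (boxGraph N) (a 0) (a 2) (a 1) (a 3) ∪ splitContact (boxGraph N) (a 0) (a 3) (a 1) (a 2)) := by
    refine measureReal_mono ?_ (measure_ne_top _ _)
    rintro ω ⟨F, hF, hTF⟩
    exact hW ↥(box 3 N) (boxGraph N) a hainj ω F hF hTF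
  -- abbreviations for the arithmetic
  set φP := (phiN N).real
    (openConn (a 0) (a 1) ∩ openConn (a 2) (a 3)) with hφP
  set φE := (phiN N).real
    {ω | ∃ F ∈ tJoins (boxGraph N) ω (univ.image a), TouchOrJoin (boxGraph N) a F} with hφE
  set ZT := zMass (boxGraph N) tc a (fun _ => True) with hZT
  set ZP := zMass (boxGraph N) tc a (TouchOrJoin (boxGraph N) a) with hZP
  have hφP0 : 0 ≤ φP := measureReal_nonneg
  have hφE0 : 0 ≤ φE := measureReal_nonneg
  have hZT0 : 0 ≤ ZT := zMass_nonneg _ tanh_criticalBeta_nonneg _ _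
  -- `hT' : φP * ZP ≤ ZT * φE`, `hLT : c * ZT ≤ ZP`, `hU' : φP ≤ K * ZT`
  have key : c * φP ≤ φE := by
    rcases hZT0.eq_or_lt with hz | hz
    · -- no `T`-join at all: `φP ≤ K·0 = 0`
      have hP0 : φP = 0 := le_antisymm (by simpa [← hz] using hU') hφP0
      rw [hP0, mul_zero]
      exact hφE0
    · have h1 : c * φP * ZT ≤ φE * ZT := by
        calc c * φP * ZT = φP * (c * ZT) := by ring
          _ ≤ φP * ZP := mul_le_mul_of_nonneg_left hLT hφP0
          _ ≤ ZT * φE := hT'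
          _ = φE * ZT := by ring
      exact le_of_mul_le_mul_right h1 hz
  exact key.trans hincl

/-- Three reachabilities from `a 0` put `ω` in the all-joined event. [folklore] -/
theorem mem_allJoined_of_three {V : Type*} {a : Fin 4 → V} {ω : Set (Sym2 V)}
    (h1 : (openGraph ω).Reachable (a 0) (a 1)) (h2 : (openGraph ω).Reachable (a 0) (a 2))
    (h3 : (openGraph ω).Reachable (a 0) (a 3)) :
    ω ∈ {ω : Set (Sym2 V) | ∀ i j, (openGraph ω).Reachable (a i) (a j)} := by
  have h : ∀ i, (openGraph ω).Reachable (a 0) (a i) := by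
    intro i
    fin_cases i
    · exact SimpleGraph.Reachable.refl _
    · exact h1
    · exact h2
    · exact h3
  intro i j
  exact (h i).symm.trans (h j)

/-- The real arithmetic of the composition, isolated from the measure-theoretic context: from
`g₁g₂ ≤ P` (FKG), `c·P ≤ U` (FK-level residual), the three union bounds `U ≤ V + s₃`, `V ≤ W + s₂`,
`W ≤ J + s₁`, and `r·s_k ≤ H_k ≤ J` (surgery + hub ⊆ joined, thrice) conclude `c·(r/(r+3))·g₁·g₂ ≤ J`. [folklore] -/
theorem crux_arith {c r g₁ g₂ P U V W J s₁ s₂ s₃ H₁ H₂ H₃ : ℝ} (hc : 0 < c) (hr : 0 < r)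
    (hFKG : g₁ * g₂ ≤ P) (hCN : c * P ≤ U) (u1 : U ≤ V + s₃) (u2 : V ≤ W + s₂) (u3 : W ≤ J + s₁)
    (h1 : r * s₁ ≤ H₁) (m1 : H₁ ≤ J) (h2 : r * s₂ ≤ H₂) (m2 : H₂ ≤ J) (h3 : r * s₃ ≤ H₃) (m3 : H₃ ≤ J) :
    c * (r / (r + 3)) * g₁ * g₂ ≤ J := by
  have hr3 : 0 < r + 3 := by linarith
  have hUB : U ≤ J + s₁ + s₂ + s₃ := by linarith
  have e1 : r * s₁ ≤ J := h1.trans m1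
  have e2 : r * s₂ ≤ J := h2.trans m2
  have e3 : r * s₃ ≤ J := h3.trans m3
  have k2 : c * (g₁ * g₂) ≤ c * P := mul_le_mul_of_nonneg_left hFKG hc.le
  have k0 : r * (c * P) ≤ r * U := mul_le_mul_of_nonneg_left hCN hr.le
  have k1 : r * U ≤ r * (J + s₁ + s₂ + s₃) := mul_le_mul_of_nonneg_left hUB hr.le
  have k1' : r * (J + s₁ + s₂ + s₃) = r * J + r * s₁ + r * s₂ + r * s₃ := by ring
  have k1'' : r * J + r * s₁ + r * s₂ + r * s₃ ≤ r * J + J + J + J := by linarith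
  have k4 : r * J + J + J + J = (r + 3) * J := by ring
  have k3 : r * (c * (g₁ * g₂)) ≤ (r + 3) * J := by
    calc r * (c * (g₁ * g₂)) ≤ r * (c * P) := mul_le_mul_of_nonneg_left k2 hr.le
      _ ≤ r * U := k0
      _ ≤ r * (J + s₁ + s₂ + s₃) := k1
      _ = r * J + r * s₁ + r * s₂ + r * s₃ := k1'
      _ ≤ r * J + J + J + J := k1''
      _ = (r + 3) * J := k4
  rw [show c * (r / (r + 3)) * g₁ * g₂ = r * (c * (g₁ * g₂)) / (r + 3) by ring]
  rw [div_le_iff₀ hr3, mul_comm J (r + 3)]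
  exact k3

/-- FK level ⇒ the crux's inner inequality (proved from stub S's STATEMENT): with `r = p_c/(2(1−p_c))`,
`φ[J ∪ S₁ ∪ S₂ ∪ S₃] ≤ φ[J] + Σ φ[S_k] ≤ (1 + 3/r)·φ[J]` and FKG `φ[01]φ[23] ≤ φ[01 ∧ 23]`, so
`ContactOrJoinFK` with constant `c` gives the crux with constant `c·r/(r+3)`. The conclusion is the
crux's statement with its `let`s unfolded (`phiN`, `allJ`, `tetra`, `boxGraph` are abbreviations of the
crux's own terms; the crux BY NAME is concluded once, in `FKFourConnectivity_of`). All measure-side facts are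
fed to `crux_arith` separately (no rewriting inside measure expressions). -/
theorem fkFour_inner_of_contactOrJoinFK
    (hS : ∀ (V : Type) [Fintype V] [DecidableEq V] (G : SimpleGraph V) [DecidableRel G.Adj] (p q : ℝ),
      p ∈ Set.Ioo (0 : ℝ) 1 → 0 < q → ∀ x y z w : V,
        p / ((1 - p) * q) * (rcMeasure G p q ∅).real (splitContact G x y z w) ≤
          (rcMeasure G p q ∅).real (hubJoined x y z w))
    (hC : ContactOrJoinFK) :
    ∃ c : ℝ, 0 < c ∧ ∀ l : ℕ, 1 ≤ l → ∃ N₀ : ℕ, ∀ N : ℕ, N₀ ≤ N →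
      ∀ a : Fin 4 → ↥(box 3 N), (∀ i, ((a i : Site 3)) = (l : ℤ) • tetra i) →
        c * (phiN N).real (openConn (a 0) (a 1)) * (phiN N).real (openConn (a 2) (a 3)) ≤
          (phiN N).real (allJ a) := by
  obtain ⟨c, hc, hC⟩ := hC
  -- the critical FK-Ising edge density `p_c = 1 − e^{−2β_c} ∈ (0, 1)` and the surgery rate `r = p_c/(2(1−p_c)) > 0`
  have hβpos : 0 < criticalBeta 3 := criticalBeta_pos_holds (d := 3) (by norm_num)
  have hβ : 0 ≤ criticalBeta 3 := criticalBeta_nonneg 3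
  have hpI : fkIsingParam (criticalBeta 3) ∈ Set.Icc (0 : ℝ) 1 := fkIsingParam_mem_Icc hβ
  have hp01 : fkIsingParam (criticalBeta 3) ∈ Set.Ioo (0 : ℝ) 1 := by
    have h1 : Real.exp (-2 * criticalBeta 3) < 1 := Real.exp_lt_one_iff.2 (by linarith)
    have h2 : 0 < Real.exp (-2 * criticalBeta 3) := Real.exp_pos _
    simp only [fkIsingParam, Set.mem_Ioo]
    constructor <;> linarith
  have h1p : 0 < 1 - fkIsingParam (criticalBeta 3) := by linarith [hp01.2]
  have hr : 0 < fkIsingParam (criticalBeta 3) / ((1 - fkIsingParam (criticalBeta 3)) * 2) :=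
    div_pos hp01.1 (mul_pos h1p two_pos)
  have hr3 : 0 < fkIsingParam (criticalBeta 3) / ((1 - fkIsingParam (criticalBeta 3)) * 2) + 3 := by linarith
  refine ⟨c * (fkIsingParam (criticalBeta 3) / ((1 - fkIsingParam (criticalBeta 3)) * 2) /
      (fkIsingParam (criticalBeta 3) / ((1 - fkIsingParam (criticalBeta 3)) * 2) + 3)),
    mul_pos hc (div_pos hr hr3), fun l hl => ?_⟩
  obtain ⟨N₀, hN₀⟩ := hC l hl
  refine ⟨N₀, fun N hN a ha => ?_⟩
  have hCN := hN₀ N hN a ha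
  haveI : IsProbabilityMeasure (phiN N) :=
    isProbabilityMeasure_rcMeasure (boxGraph N) hpI two_pos ∅
  -- (1) FKG
  have hFKG : (phiN N).real (openConn (a 0) (a 1)) * (phiN N).real (openConn (a 2) (a 3)) ≤
      (phiN N).real (openConn (a 0) (a 1) ∩ openConn (a 2) (a 3)) :=
    rcMeasure_fkg_holds (boxGraph N) hpI (by norm_num : (1 : ℝ) ≤ 2) ∅
      (isUpperSet_openConn (a 0) (a 1)) (isUpperSet_openConn (a 2) (a 3))
  -- (2) union bounds
  have u1 : (phiN N).real (allJ a ∪ splitContact (boxGraph N) (a 0) (a 1) (a 2) (a 3) ∪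
        splitContact (boxGraph N) (a 0) (a 2) (a 1) (a 3) ∪ splitContact (boxGraph N) (a 0) (a 3) (a 1) (a 2)) ≤
      (phiN N).real (allJ a ∪ splitContact (boxGraph N) (a 0) (a 1) (a 2) (a 3) ∪
        splitContact (boxGraph N) (a 0) (a 2) (a 1) (a 3)) +
      (phiN N).real (splitContact (boxGraph N) (a 0) (a 3) (a 1) (a 2)) :=
    measureReal_union_le _ _
  have u2 : (phiN N).real (allJ a ∪ splitContact (boxGraph N) (a 0) (a 1) (a 2) (a 3) ∪
        splitContact (boxGraph N) (a 0) (a 2) (a 1) (a 3)) ≤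
      (phiN N).real (allJ a ∪ splitContact (boxGraph N) (a 0) (a 1) (a 2) (a 3)) +
      (phiN N).real (splitContact (boxGraph N) (a 0) (a 2) (a 1) (a 3)) :=
    measureReal_union_le _ _
  have u3 : (phiN N).real (allJ a ∪ splitContact (boxGraph N) (a 0) (a 1) (a 2) (a 3)) ≤
      (phiN N).real (allJ a) + (phiN N).real (splitContact (boxGraph N) (a 0) (a 1) (a 2) (a 3)) :=
    measureReal_union_le _ _
  -- (3) surgery, three pairings, and hub ⊆ joined
  have hhub1 : hubJoined (a 0) (a 1) (a 2) (a 3) ⊆ allJ a :=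
    fun ω h => mem_allJoined_of_three h.1 h.2.1 h.2.2
  have hhub2 : hubJoined (a 0) (a 2) (a 1) (a 3) ⊆ allJ a :=
    fun ω h => mem_allJoined_of_three h.2.1 h.1 h.2.2
  have hhub3 : hubJoined (a 0) (a 3) (a 1) (a 2) ⊆ allJ a :=
    fun ω h => mem_allJoined_of_three h.2.1 h.2.2 h.1
  have m1 : (phiN N).real (hubJoined (a 0) (a 1) (a 2) (a 3)) ≤ (phiN N).real (allJ a) :=
    measureReal_mono hhub1 (measure_ne_top _ _)
  have m2 : (phiN N).real (hubJoined (a 0) (a 2) (a 1) (a 3)) ≤ (phiN N).real (allJ a) :=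
    measureReal_mono hhub2 (measure_ne_top _ _)
  have m3 : (phiN N).real (hubJoined (a 0) (a 3) (a 1) (a 2)) ≤ (phiN N).real (allJ a) :=
    measureReal_mono hhub3 (measure_ne_top _ _)
  have s1 : fkIsingParam (criticalBeta 3) / ((1 - fkIsingParam (criticalBeta 3)) * 2) *
        (phiN N).real (splitContact (boxGraph N) (a 0) (a 1) (a 2) (a 3)) ≤
      (phiN N).real (hubJoined (a 0) (a 1) (a 2) (a 3)) :=
    hS ↥(box 3 N) (boxGraph N) (fkIsingParam (criticalBeta 3)) 2 hp01 two_pos (a 0) (a 1) (a 2) (a 3)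
  have s2 : fkIsingParam (criticalBeta 3) / ((1 - fkIsingParam (criticalBeta 3)) * 2) *
        (phiN N).real (splitContact (boxGraph N) (a 0) (a 2) (a 1) (a 3)) ≤
      (phiN N).real (hubJoined (a 0) (a 2) (a 1) (a 3)) :=
    hS ↥(box 3 N) (boxGraph N) (fkIsingParam (criticalBeta 3)) 2 hp01 two_pos (a 0) (a 2) (a 1) (a 3)
  have s3 : fkIsingParam (criticalBeta 3) / ((1 - fkIsingParam (criticalBeta 3)) * 2) *
        (phiN N).real (splitContact (boxGraph N) (a 0) (a 3) (a 1) (a 2)) ≤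
      (phiN N).real (hubJoined (a 0) (a 3) (a 1) (a 2)) :=
    hS ↥(box 3 N) (boxGraph N) (fkIsingParam (criticalBeta 3)) 2 hp01 two_pos (a 0) (a 3) (a 1) (a 2)
  -- (4) assemble (pure real arithmetic, `crux_arith`)
  exact crux_arith hc hr hFKG hCN u1 u2 u3 s1 m1 s2 m2 s3 m3

/-! ### The composition: the stubs imply the crux BY NAME -/

/-- **`FKFourConnectivity` from the three stubs** (kernel-checked composition, no `sorry` of its own):
stub L (loop clusters touch or join) and stub W (witness) give the FK-level residual `ContactOrJoinFK`
through the proved Grimmett–Janson transfer; stub S (one-edge surgery) and FKG turn it into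
`c·r/(r+3) · φ[a₀↔a₁]φ[a₂↔a₃] ≤ φ[all joined]`, which is the crux verbatim (its `let`s unfold
definitionally: `tetra`, `boxGraph` are the crux's `let tetra`, `let G`). -/
theorem FKFourConnectivity_of :
    Summit.CriticalPhenomena.Ising3DConformalLimit.Theses.FKParityRobustness.FKFourConnectivity := by
  have h := fkFour_inner_of_contactOrJoinFK stub_contactSurgery
    (contactOrJoinFK_of_loop stub_tJoinWitness stub_loopClustersTouch)
  obtain ⟨c, hc, h⟩ := h
  refine ⟨c, hc, fun l hl => ?_⟩
  obtain ⟨N₀, hN₀⟩ := h l hl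
  refine ⟨N₀, fun N hN a ha => ?_⟩
  exact hN₀ N hN a ha

end Summit.CriticalPhenomena.Ising3DConformalLimit.Cruxes.FKFourConnectivity.LoopClusterAdjacencySurgery

end
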